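/-
COR-CM (cell pub-hodgecm2, stage 2 of the Hodge ladder) — junction B01, leaf B01-O: the PER-PAIR / EXHAUSTION reading of the coupling
in MEETING form over `Model.embOf` (x2 lane `CorCM/B01/FaceWedgeOverlap*.lean`, lead NAMING RULING HOME/INBOX l.4194 (3); meeting-form
twin of `CorCM/B01/FaceWedgeOverlapOfExhaustion.lean`, p291780, and sequel of `CorCM/B01/FaceWedgeOverlapBypassMeeting.lean`).
Authored and filed by seat prover-pub-hodgecm2-b01-x2-g3-0 (b01-x2 gen 3), 2026-08-21, on the reduction idea of
planner-pub-hodgecm2-b01-idea-1-g18-0 (IDEA-1r, per-pair settings + exhaustion) and the meeting-form currency of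
planner-pub-hodgecm2-b01-idea-2-g19-0 (IDEA-2t).  Theorems only: no `def`, no instance, no cite binder, nothing cited as a record,
nothing asserted, no `sorry`; `Interfaces.lean` (C1), the E term, `Transposition/*` and the other `CorCM/B01/*` files untouched.
T5 (standing tribunal item, COORDINATOR RULING 2026-08-21T15:33:56Z (3)): the binder set {`hS`, `hEP`} of the displays below was submitted
to pub-hodgecm2-t5-consist-1 on the exact bytes before filing (HOME/INBOX; verdict line in HOME/T5-LEDGER.md, quoted in the filing note).
FRAMING (COORDINATOR RULING 2026-08-21T11:55:35Z): HC_CM is NOT proved; B01-O is NOT proved; every displayed hypothesis below is OPEN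
at a general face and inhabited by no one.
-/
import Summits.HodgeConjecture.CorCM.B01.FaceWedgeOverlapBypassMeeting
import HarnessLib

/-!
# B01 ⇐ supply ∧ EXHAUSTION ∧ per-pair settings, MEETING form over `Model.embOf`

`FaceWedgeOverlapBypassMeeting.lean` re-cuts the split end display as `hS ∧ hM → HC_CM` with ONE isolation setting per context
`(F, f, ι₁, V)` and C5′ asked at the SATURATED (12)-sets — whose cost beyond the stage-1 package is the exhaustion input (E) PLUS the
demand that one `S₁₂` see every seesaw configuration class (idea-2 TRAP T2; own-b01 (O-J), HOME/INBOX l.4212: the tree's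
`Perl34.IsolationSetting` is ONE plane `W = W₁ ⊕ W₂ ≅ W₃ ⊕ W₄`).  THIS FILE separates the two: the theta-side binder `hEP` offers,
per context, LINE FAMILIES `Θ₀ a ⊆ U_{ψ₀}` (`a : A`), `Θ₁ b ⊆ U_{ψ₁}` (`b : B`) with
  (E)  EXHAUSTION of the two (12) slots, `U_{ψ_i}(Γ) ≤ span (⋃ Θ_i · Γ)` (i = 0, 1; the shape `hE0`/`hE1` of
       `Transposition.IsolationSpans.saturated_of_pairSettings`, `FaceWedgeOverlapOfExhaustion.lean`:227–228) — in print the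
       classification of the face-type part of `H^{1,0}` of compact `U(2,1)`-quotients by theta ∕ endoscopic packets (Rogawski 1990
       §13.3; Gelbart–Rogawski 1991 §3; [Liu 2021] Prop. 4.13 + Thm 4.18 (2)); CITE-LEVEL, typed by nobody, deliberately NOT typed here;
  (P′) for every pair `(a, b)` CARRYING A NON-ZERO THETA WEDGE `θ ∪ θ' ≠ 0` (`θ ∈ Θ₀ a Γ`, `θ' ∈ Θ₁ b Γ`) — and only for those — carrier
       types + instances, ONE isolation setting `S(a,b)` over the model's own `L²([U(V)], autMeasure V)` [(v-S)], C5′ `gen12Meet` for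
       the PAIR's theta sets `Θ₀ a × Θ₁ b` relative to `embOf` [(v-g′) at PINNED sets — PKG GENERAL shape, `Gen12MeetAt`
       `HodgeCM/Model/EndStateMeet.lean`:238], and C6′ `real34Meet` for `S(a,b)` [(v-r′), PKG GENERAL :245].
Given the supply `hS` (S2 ∕ B01-S), B01-H (the theorem `Transposition.Model.heckeWedge10_of_heckeFamily`) yields a non-zero (12)-wedge
`ω₀ ∪ ω₁` of isotypic classes; (E) and BILINEARITY of `U.cup2C` (`exists_mem_ne_zero_of_span₂`) yield a pair `(a, b)` and a non-zero
THETA wedge `θ ∪ θ'` inside `Θ₀ a × Θ₁ b` at the same level — so the joint pin (O-J) «the supplied classes must be the setting's theta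
classes» is PRODUCED from isotypic supply by exhaustion, not assumed; then the Θ-free display `Model.hc_cm_of_settingMeet_embOf`
(`FaceWedgeOverlapBypassMeeting.lean`) with `Θ := (Θ₀ a, Θ₁ b, U_{ψ₂}, U_{ψ₃})` closes.  No `TranslateClosed`, no `cover`, no (β), no
`levelMeet`; item (iii) = `Model.embOf` + D2 throughout.
RESIDUAL BINDERS after composing with a supply junction (e.g. the pinning lane's `Model.faceSupply_of_…`): the pin binders + (E) + the
per-pair (v-S)(v-g′)(v-r′) — each per-pair conjunct in the shape the stage-1 package discharges [GENERAL] for ITS configuration; whether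
EVERY wedge-carrying pair of line classes `(a, b)` at a face admits a seesaw plane is the configuration question of PerL item (iv) read
per pair (own-b01 (O-J): orthogonality ∕ (34)-splitting; idea-1 IDEA-1q §B′: «the lines are abstract»); it is DISPLAYED here, not decided.
STRENGTH: `hM` of `FaceWedgeOverlapBypassMeeting.lean` IMPLIES `hEP` (take the one-member families `Θ₀ := U_{ψ₀}`, `Θ₁ := U_{ψ₁}`:
exhaustion is then trivial and the single setting of `hM` serves every pair), so `hc_cm_of_supply_of_exhaustion_pairSettingMeet_embOf`
GENERALISES `hc_cm_of_supply_of_settingMeetSat_embOf`; the converse needs a direct sum of settings (TRAP T2) and is not claimed.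

## Contents (namespace `Summit.HodgeConjecture.CorCM`)
* `Universe.exists_mem_ne_zero_of_span₂` — bilinear expansion: `B x y ≠ 0`, `x ∈ span s`, `y ∈ span t` ⇒ `B a b ≠ 0` for some
  `a ∈ s`, `b ∈ t` (two-slot twin of `Universe.exists_mem_ne_zero_of_span`, `B01/PeriodExpansion.lean`:88).
* `Model.hc_cm_of_exists_supply_of_exhaustion_pairSettingMeet_embOf` — ∃ι₁∃V supply (token-identical to `Item6HoldsRec.lean`:208–210)
  + `hEP` ⇒ `HC_CM` on every model universe (+ `hR`).
* `Model.hc_cm_of_supply_of_exhaustion_pairSettingMeet_embOf` — the same from B01-S of record `U.FaceSupply`.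
* `Model.hc_cm_of_supply_of_exhaustion_pairSettingMeet_embOf_rec` — on the universe OF RECORD: exactly TWO hypotheses.
HC_CM is NOT proved: `hS`, `hEP` are inhabited by no one; count-neutral alternative reading, no row change.
-/

noncomputable section

set_option autoImplicit false

open scoped TensorProduct InnerProductSpace
open MeasureTheory
open Literature.AlgebraicGeometry.HodgeTheory
open Literature.NumberTheory.Automorphic
open Literature.NumberTheory.Automorphic.PicardCM

namespace Summit.HodgeConjecture.CorCM

open Literature.AlgebraicGeometry.Motives (CMType HodgeStructure)
open Literature.AlgebraicGeometry.Motives.HodgeStructure (conj)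
open Prior.Perl34File (Perl34.IsolationSetting)
open Prior.Perl34File.Perl34

/-! ## §1  Bilinear expansion -/

/-- **Bilinear expansion step**: a bilinear map that is non-zero at `(x, y)` with `x ∈ span s`, `y ∈ span t` is non-zero at some pair
of generators `(a, b) ∈ s × t` (two-slot twin of `Universe.exists_mem_ne_zero_of_span`; used with `B := U.cup2C X 1` to pass from a
non-zero (12)-wedge of isotypic classes to a non-zero wedge of THETA classes under exhaustion). [folklore] -/
theorem Universe.exists_mem_ne_zero_of_span₂ {M N P : Type*} [AddCommGroup M] [Module ℂ M] [AddCommGroup N] [Module ℂ N]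
    [AddCommGroup P] [Module ℂ P] (B : M →ₗ[ℂ] N →ₗ[ℂ] P) {s : Set M} {t : Set N} {x : M} {y : N}
    (hx : x ∈ Submodule.span ℂ s) (hy : y ∈ Submodule.span ℂ t) (hne : B x y ≠ 0) :
    ∃ a ∈ s, ∃ b ∈ t, B a b ≠ 0 := by
  by_contra h
  simp only [not_exists, not_and, not_not] at h
  -- every generator `a ∈ s` kills `span t`
  have h1 : ∀ a ∈ s, ∀ z ∈ Submodule.span ℂ t, B a z = 0 := by
    intro a ha z hz
    induction hz using Submodule.span_induction with
    | mem b hb => exact h a ha b hb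
    | zero => exact map_zero _
    | add u v _ _ hu hv => rw [map_add, hu, hv, add_zero]
    | smul c u _ hu => rw [map_smul, hu, smul_zero]
  -- hence every element of `span s` kills `y`
  have h2 : ∀ w ∈ Submodule.span ℂ s, B w y = 0 := by
    intro w hw
    induction hw using Submodule.span_induction with
    | mem a ha => exact h1 a ha y hy
    | zero => rw [map_zero, LinearMap.zero_apply]
    | add u v _ _ hu hv => rw [map_add, LinearMap.add_apply, hu, hv, add_zero]
    | smul c u _ hu => rw [map_smul, LinearMap.smul_apply, hu, smul_zero]
  exact hne (h2 x hx)

namespace Model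

/-! ## §2  Supply + exhaustion + per-pair settings ⇒ `HC_CM`, meeting form over `embOf` -/

/-- **SPLIT END DISPLAY, PER-PAIR ∕ EXHAUSTION READING, MEETING FORM, ∃ι₁∃V SUPPLY.**  On every model universe
`picardCMUniverse hHD hI h₁ h₃` (+ Deligne–Milne `hR`): the supply `hS` (token-identical to `Model.hc_cm_of_supply_of_dictionary_of_eq`'s,
`Item6HoldsRec.lean`:208–210) and the theta-side binder `hEP` — per context `(F, f, ι₁, V)`: line families `Θ₀ ⊆ U_{ψ₀}`, `Θ₁ ⊆ U_{ψ₁}`,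
(E) EXHAUSTION of the two (12) slots, and for every pair `(a, b)` carrying a non-zero theta wedge an isolation setting over
`Lp ℂ 2 V.autMeasure` with C5′ for the pair's theta sets and C6′, both relative to `Model.embOf` — give `HC_CM`.  Proof: non-zero
isotypic (12)-wedge from `hS` + B01-H (`faceThetaSupplyWedgeExists_iff_exists_supply'`, `Transposition.exists_lineField_witness`); by (E) and
`Universe.exists_mem_ne_zero_of_span₂` a pair `(a, b)` with a non-zero THETA wedge at the same level; `hEP`'s setting for that pair; then
`hc_cm_of_settingMeet_embOf`'s engine `periodNV_of_settingMeet_embOf` with `Θ := (Θ₀ a, Θ₁ b, U_{ψ₂}, U_{ψ₃})` and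
`hc_cm_of_exists_facePeriod` (σ := ι₁).  No `TranslateClosed`, no `cover`, no (β).  HC_CM is NOT proved: `hS`, `hEP` are inhabited by
no one. [folklore] -/
theorem hc_cm_of_exists_supply_of_exhaustion_pairSettingMeet_embOf (hHD : exists_isReal_hodgeModel)
    (hI : hodgePQ_independent_of_hodgeModel) (h₁ : BallQuotientUniformised) (h₃ : CMAbelianVarietyRealised)
    (hR : DeligneMilne1982_Thm_6_20_full)
    (hS : ∀ (F : CMField), IsGalois ℚ F → 6 ≤ Module.finrank ℚ F → ∀ f : Face F,
      ∃ ι₁ : F →+* ℂ, f.Admissible ι₁ ∧ ∃ (V : HermSpace3 F ι₁) (Γ : Level V)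
        (ω₀ ω₁ : (picardCMUniverse hHD hI h₁ h₃).CohC ((picardCMUniverse hHD hI h₁ h₃).pms F ι₁ V Γ) 1),
        ω₀ ∈ (picardCMUniverse hHD hI h₁ h₃).Uiso Γ F (f.psi 0) ι₁ ∧
          ω₁ ∈ (picardCMUniverse hHD hI h₁ h₃).Uiso Γ F (f.psi 1) ι₁ ∧ ω₀ ≠ 0 ∧ ω₁ ≠ 0)
    (hEP : ∀ (F : CMField), IsGalois ℚ F → 6 ≤ Module.finrank ℚ F → ∀ (f : Face F) (ι₁ : F →+* ℂ), f.Admissible ι₁ →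
      ∀ V : HermSpace3 F ι₁,
      ∃ (A B : Type) (Θ₀ : A → ∀ Γ : Level V, Set ((picardCMUniverse hHD hI h₁ h₃).CohC ((picardCMUniverse hHD hI h₁ h₃).pms F ι₁ V Γ) 1))
        (Θ₁ : B → ∀ Γ : Level V, Set ((picardCMUniverse hHD hI h₁ h₃).CohC ((picardCMUniverse hHD hI h₁ h₃).pms F ι₁ V Γ) 1)),
        (∀ (a : A) (Γ : Level V), Θ₀ a Γ ⊆ (picardCMUniverse hHD hI h₁ h₃).Uiso Γ F (f.psi 0) ι₁) ∧
        (∀ (b : B) (Γ : Level V), Θ₁ b Γ ⊆ (picardCMUniverse hHD hI h₁ h₃).Uiso Γ F (f.psi 1) ι₁) ∧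
        (∀ Γ : Level V, (picardCMUniverse hHD hI h₁ h₃).Uiso Γ F (f.psi 0) ι₁ ≤ Submodule.span ℂ (⋃ a, Θ₀ a Γ)) ∧
        (∀ Γ : Level V, (picardCMUniverse hHD hI h₁ h₃).Uiso Γ F (f.psi 1) ι₁ ≤ Submodule.span ℂ (⋃ b, Θ₁ b Γ)) ∧
        ∀ (a : A) (b : B),
          (∃ (Γ : Level V), ∃ θ ∈ Θ₀ a Γ, ∃ θ' ∈ Θ₁ b Γ, (picardCMUniverse hHD hI h₁ h₃).cup2C ((picardCMUniverse hHD hI h₁ h₃).pms F ι₁ V Γ) 1 θ θ' ≠ 0) →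
          ∃ (H CG G SK SigIdx SigIdxG : Type) (_ : NormedAddCommGroup H) (_ : InnerProductSpace ℂ H) (_ : CompleteSpace H)
            (_ : NormedAddCommGroup CG) (_ : NormedSpace ℂ CG) (_ : Group G) (_ : TopologicalSpace G) (_ : TopologicalSpace SK)
            (S : Perl34.IsolationSetting H (Lp ℂ 2 V.autMeasure) CG G SK SigIdx SigIdxG),
            (∀ (Γ : Level V) (ω₁ ω₂ : (picardCMUniverse hHD hI h₁ h₃).CohC ((picardCMUniverse hHD hI h₁ h₃).pms F ι₁ V Γ) 1), ω₁ ∈ Θ₀ a Γ → ω₂ ∈ Θ₁ b Γ →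
                embOf hHD hI (ballQuotientUniformisedDatum_of h₁) h₃ Γ ((picardCMUniverse hHD hI h₁ h₃).cup2C ((picardCMUniverse hHD hI h₁ h₃).pms F ι₁ V Γ) 1 ω₁ ω₂) ≠ 0 →
                  ∃ u ∈ S.t12.S12, ⟪embOf hHD hI (ballQuotientUniformisedDatum_of h₁) h₃ Γ ((picardCMUniverse hHD hI h₁ h₃).cup2C ((picardCMUniverse hHD hI h₁ h₃).pms F ι₁ V Γ) 1 ω₁ ω₂), u⟫_ℂ ≠ 0) ∧
            (∀ χ : S.t34.X, S.t34.allowed χ → ∀ (Φ : SK) (Γ₁ : Level V)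
              (ω₁ ω₂ : (picardCMUniverse hHD hI h₁ h₃).CohC ((picardCMUniverse hHD hI h₁ h₃).pms F ι₁ V Γ₁) 1),
              ω₁ ∈ (picardCMUniverse hHD hI h₁ h₃).Uiso Γ₁ F (f.psi 0) ι₁ →
              ω₂ ∈ (picardCMUniverse hHD hI h₁ h₃).Uiso Γ₁ F (f.psi 1) ι₁ →
                ⟪embOf hHD hI (ballQuotientUniformisedDatum_of h₁) h₃ Γ₁
                    ((picardCMUniverse hHD hI h₁ h₃).cup2C ((picardCMUniverse hHD hI h₁ h₃).pms F ι₁ V Γ₁) 1 ω₁ ω₂),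
                  S.t34.ϑ χ Φ⟫_ℂ ≠ 0 →
                  ∃ (Γ : Level V) (ω : Fin 4 → (picardCMUniverse hHD hI h₁ h₃).CohC ((picardCMUniverse hHD hI h₁ h₃).pms F ι₁ V Γ) 1),
                    (∀ i, ω i ∈ (picardCMUniverse hHD hI h₁ h₃).Uiso Γ F (f.psi i) ι₁) ∧
                      ⟪embOf hHD hI (ballQuotientUniformisedDatum_of h₁) h₃ Γ
                          ((picardCMUniverse hHD hI h₁ h₃).cup2C ((picardCMUniverse hHD hI h₁ h₃).pms F ι₁ V Γ) 1 (ω 2) (ω 3)),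
                        embOf hHD hI (ballQuotientUniformisedDatum_of h₁) h₃ Γ
                          ((picardCMUniverse hHD hI h₁ h₃).cup2C ((picardCMUniverse hHD hI h₁ h₃).pms F ι₁ V Γ) 1 (ω 0) (ω 1))⟫_ℂ
                        ≠ 0)) :
    HC_CM := by
  refine hc_cm_of_exists_facePeriod hHD hI h₁ h₃ ?_ hR
  intro F hG h6 f
  obtain ⟨ι₁, hι, V, Γ, ω₀, ω₁, h0, h1, hne⟩ := Transposition.exists_lineField_witness
    ((faceThetaSupplyWedgeExists_iff_exists_supply' hHD hI h₁ h₃).mpr hS) F hG h6 f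
  obtain ⟨A, B, Θ₀, Θ₁, hs0, hs1, hE0, hE1, hP⟩ := hEP F hG h6 f ι₁ hι V
  -- exhaustion + bilinearity: a non-zero THETA wedge at the level `Γ`, for some pair `(a, b)`
  obtain ⟨θ, hθ, θ', hθ', hneθ⟩ := Universe.exists_mem_ne_zero_of_span₂
    ((picardCMUniverse hHD hI h₁ h₃).cup2C ((picardCMUniverse hHD hI h₁ h₃).pms F ι₁ V Γ) 1) (hE0 Γ h0) (hE1 Γ h1) hne
  obtain ⟨a, hθa⟩ := Set.mem_iUnion.mp hθ
  obtain ⟨b, hθb⟩ := Set.mem_iUnion.mp hθ'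
  obtain ⟨H, CG, G, SK, SigIdx, SigIdxG, _, _, _, _, _, _, _, _, S, hg, hr⟩ := hP a b ⟨Γ, θ, hθa, θ', hθb, hneθ⟩
  have hL : 2 < Module.finrank ℚ F := by omega
  -- the pair's theta sets in slots 0, 1; the isotypic spaces in slots 2, 3
  let Θ : Fin 4 → ∀ Γ' : Level V,
      Set ((picardCMUniverse hHD hI h₁ h₃).CohC ((picardCMUniverse hHD hI h₁ h₃).pms F ι₁ V Γ') 1) := fun i Γ' =>
    {η | (i = 0 → η ∈ Θ₀ a Γ') ∧ (i = 1 → η ∈ Θ₁ b Γ') ∧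
      (i = 2 → η ∈ (picardCMUniverse hHD hI h₁ h₃).Uiso Γ' F (f.psi 2) ι₁) ∧
      (i = 3 → η ∈ (picardCMUniverse hHD hI h₁ h₃).Uiso Γ' F (f.psi 3) ι₁)}
  have hsub : ∀ (i : Fin 4) (Γ' : Level V), Θ i Γ' ⊆ (picardCMUniverse hHD hI h₁ h₃).Uiso Γ' F (f.psi i) ι₁ := by
    intro i Γ' η hη
    obtain ⟨hη0, hη1, hη2, hη3⟩ := hη
    match i with
    | 0 => exact hs0 a Γ' (hη0 rfl)
    | 1 => exact hs1 b Γ' (hη1 rfl)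
    | 2 => exact hη2 rfl
    | 3 => exact hη3 rfl
  have m0 : θ ∈ Θ 0 Γ :=
    ⟨fun _ => hθa, fun h => absurd h (by decide), fun h => absurd h (by decide), fun h => absurd h (by decide)⟩
  have m1 : θ' ∈ Θ 1 Γ :=
    ⟨fun h => absurd h (by decide), fun _ => hθb, fun h => absurd h (by decide), fun h => absurd h (by decide)⟩
  refine ⟨ι₁, hι, V, ι₁, periodNV_of_settingMeet_embOf hHD hI (ballQuotientUniformisedDatum_of h₁) h₃ hL V S (Θ := Θ) hsub
    ⟨Γ, θ, m0, θ', m1, hneθ⟩ ?_ hr⟩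
  intro Γ' η η' hη hη' hne'
  exact hg Γ' η η' (hη.1 rfl) (hη'.2.1 rfl) hne'

/-- **The same from B01-S OF RECORD** `U.FaceSupply` (`B01/FaceInputsSplit.lean`:50; the conclusion of the pinning lane's supply
junctions), via `faceThetaSupplyWedgeExists_of_faceSupply'` + `Transposition.exists_supply_witness`.  After composing with a supply
junction the displayed binders are: its binders + `hEP`.  HC_CM is NOT proved: `hS`, `hEP` are inhabited by no one. [folklore] -/
theorem hc_cm_of_supply_of_exhaustion_pairSettingMeet_embOf (hHD : exists_isReal_hodgeModel)
    (hI : hodgePQ_independent_of_hodgeModel) (h₁ : BallQuotientUniformised) (h₃ : CMAbelianVarietyRealised)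
    (hR : DeligneMilne1982_Thm_6_20_full) (hS : (picardCMUniverse hHD hI h₁ h₃).FaceSupply)
    (hEP : ∀ (F : CMField), IsGalois ℚ F → 6 ≤ Module.finrank ℚ F → ∀ (f : Face F) (ι₁ : F →+* ℂ), f.Admissible ι₁ →
      ∀ V : HermSpace3 F ι₁,
      ∃ (A B : Type) (Θ₀ : A → ∀ Γ : Level V, Set ((picardCMUniverse hHD hI h₁ h₃).CohC ((picardCMUniverse hHD hI h₁ h₃).pms F ι₁ V Γ) 1))
        (Θ₁ : B → ∀ Γ : Level V, Set ((picardCMUniverse hHD hI h₁ h₃).CohC ((picardCMUniverse hHD hI h₁ h₃).pms F ι₁ V Γ) 1)),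
        (∀ (a : A) (Γ : Level V), Θ₀ a Γ ⊆ (picardCMUniverse hHD hI h₁ h₃).Uiso Γ F (f.psi 0) ι₁) ∧
        (∀ (b : B) (Γ : Level V), Θ₁ b Γ ⊆ (picardCMUniverse hHD hI h₁ h₃).Uiso Γ F (f.psi 1) ι₁) ∧
        (∀ Γ : Level V, (picardCMUniverse hHD hI h₁ h₃).Uiso Γ F (f.psi 0) ι₁ ≤ Submodule.span ℂ (⋃ a, Θ₀ a Γ)) ∧
        (∀ Γ : Level V, (picardCMUniverse hHD hI h₁ h₃).Uiso Γ F (f.psi 1) ι₁ ≤ Submodule.span ℂ (⋃ b, Θ₁ b Γ)) ∧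
        ∀ (a : A) (b : B),
          (∃ (Γ : Level V), ∃ θ ∈ Θ₀ a Γ, ∃ θ' ∈ Θ₁ b Γ, (picardCMUniverse hHD hI h₁ h₃).cup2C ((picardCMUniverse hHD hI h₁ h₃).pms F ι₁ V Γ) 1 θ θ' ≠ 0) →
          ∃ (H CG G SK SigIdx SigIdxG : Type) (_ : NormedAddCommGroup H) (_ : InnerProductSpace ℂ H) (_ : CompleteSpace H)
            (_ : NormedAddCommGroup CG) (_ : NormedSpace ℂ CG) (_ : Group G) (_ : TopologicalSpace G) (_ : TopologicalSpace SK)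
            (S : Perl34.IsolationSetting H (Lp ℂ 2 V.autMeasure) CG G SK SigIdx SigIdxG),
            (∀ (Γ : Level V) (ω₁ ω₂ : (picardCMUniverse hHD hI h₁ h₃).CohC ((picardCMUniverse hHD hI h₁ h₃).pms F ι₁ V Γ) 1), ω₁ ∈ Θ₀ a Γ → ω₂ ∈ Θ₁ b Γ →
                embOf hHD hI (ballQuotientUniformisedDatum_of h₁) h₃ Γ ((picardCMUniverse hHD hI h₁ h₃).cup2C ((picardCMUniverse hHD hI h₁ h₃).pms F ι₁ V Γ) 1 ω₁ ω₂) ≠ 0 →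
                  ∃ u ∈ S.t12.S12, ⟪embOf hHD hI (ballQuotientUniformisedDatum_of h₁) h₃ Γ ((picardCMUniverse hHD hI h₁ h₃).cup2C ((picardCMUniverse hHD hI h₁ h₃).pms F ι₁ V Γ) 1 ω₁ ω₂), u⟫_ℂ ≠ 0) ∧
            (∀ χ : S.t34.X, S.t34.allowed χ → ∀ (Φ : SK) (Γ₁ : Level V)
              (ω₁ ω₂ : (picardCMUniverse hHD hI h₁ h₃).CohC ((picardCMUniverse hHD hI h₁ h₃).pms F ι₁ V Γ₁) 1),
              ω₁ ∈ (picardCMUniverse hHD hI h₁ h₃).Uiso Γ₁ F (f.psi 0) ι₁ →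
              ω₂ ∈ (picardCMUniverse hHD hI h₁ h₃).Uiso Γ₁ F (f.psi 1) ι₁ →
                ⟪embOf hHD hI (ballQuotientUniformisedDatum_of h₁) h₃ Γ₁
                    ((picardCMUniverse hHD hI h₁ h₃).cup2C ((picardCMUniverse hHD hI h₁ h₃).pms F ι₁ V Γ₁) 1 ω₁ ω₂),
                  S.t34.ϑ χ Φ⟫_ℂ ≠ 0 →
                  ∃ (Γ : Level V) (ω : Fin 4 → (picardCMUniverse hHD hI h₁ h₃).CohC ((picardCMUniverse hHD hI h₁ h₃).pms F ι₁ V Γ) 1),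
                    (∀ i, ω i ∈ (picardCMUniverse hHD hI h₁ h₃).Uiso Γ F (f.psi i) ι₁) ∧
                      ⟪embOf hHD hI (ballQuotientUniformisedDatum_of h₁) h₃ Γ
                          ((picardCMUniverse hHD hI h₁ h₃).cup2C ((picardCMUniverse hHD hI h₁ h₃).pms F ι₁ V Γ) 1 (ω 2) (ω 3)),
                        embOf hHD hI (ballQuotientUniformisedDatum_of h₁) h₃ Γ
                          ((picardCMUniverse hHD hI h₁ h₃).cup2C ((picardCMUniverse hHD hI h₁ h₃).pms F ι₁ V Γ) 1 (ω 0) (ω 1))⟫_ℂ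
                        ≠ 0)) :
    HC_CM :=
  hc_cm_of_exists_supply_of_exhaustion_pairSettingMeet_embOf hHD hI h₁ h₃ hR
    (Transposition.exists_supply_witness (faceThetaSupplyWedgeExists_of_faceSupply' hHD hI h₁ h₃ hS)) hEP

/-! ## §3  The universe of record -/

/-- **The per-pair ∕ exhaustion meeting-form display on the universe OF RECORD** (the four `_holds` data and
`deligneMilne1982_Thm_6_20_full_holds` plugged in; `let U := U_rec`, `let hU := …` for legibility): `HC_CM` from EXACTLY TWO displayed
hypotheses, B01-S of record and `hEP` = {line families, (E) exhaustion, per wedge-carrying pair one isolation setting with C5′ (pinned)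
and C6′ over `Model.embOf`}.  HC_CM is NOT proved: both are open at a general face. [folklore] -/
theorem hc_cm_of_supply_of_exhaustion_pairSettingMeet_embOf_rec :
    let U := picardCMUniverse exists_isReal_hodgeModel_holds hodgePQ_independent_of_hodgeModel_holds
      BallQuotient.ballQuotientUniformised_holds cmAbelianVarietyRealised_holds
    let hU := ballQuotientUniformisedDatum_of BallQuotient.ballQuotientUniformised_holds
    U.FaceSupply →
    (∀ (F : CMField), IsGalois ℚ F → 6 ≤ Module.finrank ℚ F → ∀ (f : Face F) (ι₁ : F →+* ℂ), f.Admissible ι₁ →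
      ∀ V : HermSpace3 F ι₁,
      ∃ (A B : Type) (Θ₀ : A → ∀ Γ : Level V, Set (U.CohC (U.pms F ι₁ V Γ) 1))
        (Θ₁ : B → ∀ Γ : Level V, Set (U.CohC (U.pms F ι₁ V Γ) 1)),
        (∀ (a : A) (Γ : Level V), Θ₀ a Γ ⊆ U.Uiso Γ F (f.psi 0) ι₁) ∧
        (∀ (b : B) (Γ : Level V), Θ₁ b Γ ⊆ U.Uiso Γ F (f.psi 1) ι₁) ∧
        (∀ Γ : Level V, U.Uiso Γ F (f.psi 0) ι₁ ≤ Submodule.span ℂ (⋃ a, Θ₀ a Γ)) ∧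
        (∀ Γ : Level V, U.Uiso Γ F (f.psi 1) ι₁ ≤ Submodule.span ℂ (⋃ b, Θ₁ b Γ)) ∧
        ∀ (a : A) (b : B),
          (∃ (Γ : Level V), ∃ θ ∈ Θ₀ a Γ, ∃ θ' ∈ Θ₁ b Γ, U.cup2C (U.pms F ι₁ V Γ) 1 θ θ' ≠ 0) →
          ∃ (H CG G SK SigIdx SigIdxG : Type) (_ : NormedAddCommGroup H) (_ : InnerProductSpace ℂ H) (_ : CompleteSpace H)
            (_ : NormedAddCommGroup CG) (_ : NormedSpace ℂ CG) (_ : Group G) (_ : TopologicalSpace G) (_ : TopologicalSpace SK)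
            (S : Perl34.IsolationSetting H (Lp ℂ 2 V.autMeasure) CG G SK SigIdx SigIdxG),
            (∀ (Γ : Level V) (ω₁ ω₂ : U.CohC (U.pms F ι₁ V Γ) 1), ω₁ ∈ Θ₀ a Γ → ω₂ ∈ Θ₁ b Γ →
                embOf exists_isReal_hodgeModel_holds hodgePQ_independent_of_hodgeModel_holds hU cmAbelianVarietyRealised_holds Γ (U.cup2C (U.pms F ι₁ V Γ) 1 ω₁ ω₂) ≠ 0 →
                  ∃ u ∈ S.t12.S12, ⟪embOf exists_isReal_hodgeModel_holds hodgePQ_independent_of_hodgeModel_holds hU cmAbelianVarietyRealised_holds Γ (U.cup2C (U.pms F ι₁ V Γ) 1 ω₁ ω₂), u⟫_ℂ ≠ 0) ∧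
            (∀ χ : S.t34.X, S.t34.allowed χ → ∀ (Φ : SK) (Γ₁ : Level V)
              (ω₁ ω₂ : U.CohC (U.pms F ι₁ V Γ₁) 1),
              ω₁ ∈ U.Uiso Γ₁ F (f.psi 0) ι₁ →
              ω₂ ∈ U.Uiso Γ₁ F (f.psi 1) ι₁ →
                ⟪embOf exists_isReal_hodgeModel_holds hodgePQ_independent_of_hodgeModel_holds hU cmAbelianVarietyRealised_holds Γ₁
                    (U.cup2C (U.pms F ι₁ V Γ₁) 1 ω₁ ω₂),
                  S.t34.ϑ χ Φ⟫_ℂ ≠ 0 →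
                  ∃ (Γ : Level V) (ω : Fin 4 → U.CohC (U.pms F ι₁ V Γ) 1),
                    (∀ i, ω i ∈ U.Uiso Γ F (f.psi i) ι₁) ∧
                      ⟪embOf exists_isReal_hodgeModel_holds hodgePQ_independent_of_hodgeModel_holds hU cmAbelianVarietyRealised_holds Γ
                          (U.cup2C (U.pms F ι₁ V Γ) 1 (ω 2) (ω 3)),
                        embOf exists_isReal_hodgeModel_holds hodgePQ_independent_of_hodgeModel_holds hU cmAbelianVarietyRealised_holds Γ
                          (U.cup2C (U.pms F ι₁ V Γ) 1 (ω 0) (ω 1))⟫_ℂ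
                        ≠ 0)) →
    HC_CM :=
  fun hS hEP ↦ hc_cm_of_supply_of_exhaustion_pairSettingMeet_embOf _ _ _ _ deligneMilne1982_Thm_6_20_full_holds hS hEP

#print axioms Summit.HodgeConjecture.CorCM.Universe.exists_mem_ne_zero_of_span₂
#print axioms hc_cm_of_exists_supply_of_exhaustion_pairSettingMeet_embOf
#print axioms hc_cm_of_supply_of_exhaustion_pairSettingMeet_embOf
#print axioms hc_cm_of_supply_of_exhaustion_pairSettingMeet_embOf_rec

end Model

end Summit.HodgeConjecture.CorCM

end
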